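import Literature.MathematicalPhysics.QuantumLattice.KagomeLattice
import Literature.Probability.LatticeModels.TriangularLatticeProofs
import HarnessLib

/-!
# The kagome lattice is the line graph of the honeycomb lattice (`KagomeLattice`): proof

Topic `MathematicalPhysics/QuantumLattice`. Sibling proof file of
`Literature/MathematicalPhysics/QuantumLattice/KagomeLattice.lean`: it discharges the named fact
`kagomeGraph_iso_lineGraph_hexGraph` (`def … : Prop`, D-0014) of that file as
`theorem kagomeGraph_iso_lineGraph_hexGraph_holds : kagomeGraph_iso_lineGraph_hexGraph`, i.e.
`Nonempty (kagomeGraph ≃g hexGraph.lineGraph)`, from Mathlib (`SimpleGraph.lineGraph`,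
`Equiv.ofBijective`) and the accepted files `KagomeLattice` (`kagomeGraph_adj_iff`,
`kagomeAdjRel_shift_iff`) and `TriangularLatticeProofs` (the three neighbours of a face of `𝕋`:
`hexGraph_adj_iff_of_snd_eq_zero_holds`, `hexGraph_adj_iff_of_snd_eq_one`,
`not_hexGraph_adj_of_snd_eq_holds`). No statement is introduced or changed here; the auxiliary
definitions below are the explicit isomorphism and carry no new named fact.

## The isomorphism

A kagome site `(x, s) : KagomeVertex = ℤ² × Fin 3` is the midpoint of the edge
`kagomeEdge (x, s)` of `𝕋`, which borders exactly two faces of `𝕋`, i.e. two vertices of the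
honeycomb lattice `hexGraph`: the up face `(x, 0)` of its own cell and the down face
`(x - kagomeDownShift s, 1)` with `kagomeDownShift = (e₁, e₀, 0)` (`{x, x + e₀}` borders the
down triangle of the cell `x - e₁`, `{x, x + e₁}` that of the cell `x - e₀`, and
`{x + e₀, x + e₁}` that of the cell `x`). The map

  `kagomeToHexEdge (x, s) = {(x, 0), (x - kagomeDownShift s, 1)} ∈ hexGraph.edgeSet`

(`kagomeHexEdge`, `kagomeHexEdge_mem_edgeSet`) is a bijection onto the edges of the honeycomb
lattice (`kagomeToHexEdge_injective`; `kagomeToHexEdge_surjective`, because faces of equal type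
are never adjacent and the up face `(x, 0)` is adjacent exactly to the down faces of the cells
`x`, `x - e₀`, `x - e₁`), and two kagome sites are adjacent iff they are distinct and share
their up cell or their down cell (`kagomeGraph_adj_iff_cell`, a finite check on the table
`KagomeAdjRel` after translating to the origin), which is exactly the statement that the two
honeycomb edges are distinct and share an endpoint (`lineGraph_adj_kagomeToHexEdge_iff`). Hence
`kagomeIsoLineGraphHex : kagomeGraph ≃g hexGraph.lineGraph`.

## Sources

Savary–Balents, *Quantum spin liquids: a review*, Rep. Prog. Phys. **80** (2017) 016502
(arXiv:1601.03742), §6.4.2 "Kagomé models" (arXiv numbering): the kagomé lattice of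
corner-sharing triangles [cite: SavaryBalents2017, §6.4.2]. The identification of the kagomé
lattice with the line graph of the hexagonal (honeycomb) lattice is the standard one used by
A. Mielke, *Exact ground states for the Hubbard model on the Kagome lattice*, J. Phys. A **25**
(1992) 4335 (`Mielke1992` in `references.bib`; flat-band ferromagnetism on line graphs); neither
source spells out the elementary verification in coordinates, which is carried out here for the
encoding of `KagomeLattice.lean` and the honeycomb lattice `hexGraph` of `TriangularLattice.lean`
(Grimmett, *Percolation* (1999), §1.6, Fig. 1.7).
-/

namespace Literature.MathematicalPhysics.QuantumLattice

open Literature.Probability.LatticeModels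

/-! ### The two faces of a kagome site -/

/-- The shift from the cell of a kagome site `(x, s)` to the cell of its down triangle: the edge
`kagomeEdge (x, s)` of `𝕋` borders the up face `(x, 0)` and the down face
`(x - kagomeDownShift s, 1)`, with `kagomeDownShift = (e₁, e₀, 0)`. [folklore] -/
def kagomeDownShift : Fin 3 → Site 2 :=
  ![Pi.single 1 1, Pi.single 0 1, 0]

/-- `kagomeDownShift 0 = e₁`. [folklore] -/
@[simp] theorem kagomeDownShift_zero : kagomeDownShift 0 = Pi.single 1 1 := rfl

/-- `kagomeDownShift 1 = e₀`. [folklore] -/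
@[simp] theorem kagomeDownShift_one : kagomeDownShift 1 = Pi.single 0 1 := rfl

/-- `kagomeDownShift 2 = 0`. [folklore] -/
@[simp] theorem kagomeDownShift_two : kagomeDownShift 2 = 0 := rfl

/-- The three down-cell shifts `e₁, e₀, 0` are distinct. [folklore] -/
theorem kagomeDownShift_injective : Function.Injective kagomeDownShift := by
  unfold Function.Injective kagomeDownShift
  decide

/-- The edge of the honeycomb lattice dual to the edge `kagomeEdge v` of `𝕋`: the unordered pair
of the two faces of `𝕋` bordering it, `{(x, 0), (x - kagomeDownShift s, 1)}` for `v = (x, s)`.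
(Kagome sites = edges of the hexagonal lattice: Mielke 1992; Savary–Balents 2017, §6.4.2.)
[cite: SavaryBalents2017, §6.4.2] -/
def kagomeHexEdge (v : KagomeVertex) : Sym2 HexVertex :=
  s((v.1, 0), (v.1 - kagomeDownShift v.2, 1))

/-- `kagomeHexEdge v` is an edge of the honeycomb lattice: the up face of the cell `x` is
adjacent to the down faces of the cells `x`, `x - e₀`, `x - e₁`
(`hexGraph_adj_iff_of_snd_eq_zero`). [folklore] -/
theorem kagomeHexEdge_mem_edgeSet (v : KagomeVertex) : kagomeHexEdge v ∈ hexGraph.edgeSet := by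
  obtain ⟨x, s⟩ := v
  refine (hexGraph_adj_iff_of_snd_eq_zero_holds x _).2 ?_
  fin_cases s
  · exact Or.inr (Or.inr rfl)
  · exact Or.inr (Or.inl rfl)
  · exact Or.inl (sub_zero x)

/-- The kagome site `v` as a vertex of the line graph of the honeycomb lattice, i.e. as the
honeycomb edge `kagomeHexEdge v`. (Mielke 1992; Savary–Balents 2017, §6.4.2.)
[cite: SavaryBalents2017, §6.4.2] -/
def kagomeToHexEdge (v : KagomeVertex) : hexGraph.edgeSet :=
  ⟨kagomeHexEdge v, kagomeHexEdge_mem_edgeSet v⟩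

/-- `kagomeToHexEdge` as an unordered pair of faces. [folklore] -/
@[simp] theorem coe_kagomeToHexEdge (v : KagomeVertex) :
    (kagomeToHexEdge v : Sym2 HexVertex) = kagomeHexEdge v := rfl

/-- `kagomeHexEdge` is injective: the pair of faces determines the up cell `x` and the down-cell
shift, hence the sublattice. [folklore] -/
theorem kagomeHexEdge_injective : Function.Injective kagomeHexEdge := by
  rintro ⟨x, s⟩ ⟨y, t⟩ h
  simp only [kagomeHexEdge] at h
  rcases Sym2.eq_iff.1 h with ⟨h₁, h₂⟩ | ⟨h₁, -⟩
  · obtain rfl : x = y := (Prod.mk.inj h₁).1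
    have hst : kagomeDownShift s = kagomeDownShift t := sub_right_inj.1 (Prod.mk.inj h₂).1
    rw [kagomeDownShift_injective hst]
  · exact absurd (Prod.mk.inj h₁).2 (by decide)

/-- `kagomeToHexEdge` is injective. [folklore] -/
theorem kagomeToHexEdge_injective : Function.Injective kagomeToHexEdge := fun _ _ h =>
  kagomeHexEdge_injective (congrArg Subtype.val h)

/-- `kagomeToHexEdge` is surjective: every edge of the honeycomb lattice joins an up face `(x, 0)`
to one of the down faces `(x, 1)`, `(x - e₀, 1)`, `(x - e₁, 1)`, which are the images of the
kagome sites `(x, 2)`, `(x, 1)`, `(x, 0)`. [folklore] -/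
theorem kagomeToHexEdge_surjective : Function.Surjective kagomeToHexEdge := by
  rintro ⟨e, he⟩
  induction e with
  | h f g =>
    obtain ⟨x, k⟩ := f
    obtain ⟨y, l⟩ := g
    have hadj : hexGraph.Adj (x, k) (y, l) := he
    fin_cases k <;> fin_cases l
    · exact absurd hadj (not_hexGraph_adj_of_snd_eq_holds _ _ rfl)
    · rcases (hexGraph_adj_iff_of_snd_eq_zero_holds x y).1 hadj with h | h | h
      · exact ⟨(x, 2), Subtype.ext (by simp [kagomeHexEdge, h])⟩
      · exact ⟨(x, 1), Subtype.ext (by simp [kagomeHexEdge, h])⟩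
      · exact ⟨(x, 0), Subtype.ext (by simp [kagomeHexEdge, h])⟩
    · rcases (hexGraph_adj_iff_of_snd_eq_one x y).1 hadj with h | h | h
      · refine ⟨(x, 2), Subtype.ext ?_⟩
        simp only [coe_kagomeToHexEdge, kagomeHexEdge, kagomeDownShift_two, sub_zero, h]
        exact Sym2.eq_swap
      · refine ⟨(y, 1), Subtype.ext ?_⟩
        simp only [coe_kagomeToHexEdge, kagomeHexEdge, kagomeDownShift_one, h,
          add_sub_cancel_right]
        exact Sym2.eq_swap
      · refine ⟨(y, 0), Subtype.ext ?_⟩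
        simp only [coe_kagomeToHexEdge, kagomeHexEdge, kagomeDownShift_zero, h,
          add_sub_cancel_right]
        exact Sym2.eq_swap
    · exact absurd hadj (not_hexGraph_adj_of_snd_eq_holds _ _ rfl)

/-- `kagomeToHexEdge` is a bijection from the kagome sites onto the edges of the honeycomb
lattice. (Mielke 1992; Savary–Balents 2017, §6.4.2.) [cite: SavaryBalents2017, §6.4.2] -/
theorem kagomeToHexEdge_bijective : Function.Bijective kagomeToHexEdge :=
  ⟨kagomeToHexEdge_injective, kagomeToHexEdge_surjective⟩

/-! ### Adjacency: common up triangle or common down triangle -/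

/-- The symmetrised kagome table in terms of cells: two distinct sites `(x, s)`, `(y, t)` are
related iff they have the same up cell (`x = y`) or the same down cell
(`x - kagomeDownShift s = y - kagomeDownShift t`). The nontrivial direction is a finite check on
the table after translating `x` to the origin (`kagomeAdjRel_shift_iff`). [folklore] -/
theorem kagomeAdjRel_or_symm_iff_cell {x y : Site 2} {s t : Fin 3} (hne : (x, s) ≠ (y, t)) :
    (KagomeAdjRel ℤ (x, s) (y, t) ∨ KagomeAdjRel ℤ (y, t) (x, s)) ↔
      (x = y ∨ x - kagomeDownShift s = y - kagomeDownShift t) := by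
  constructor
  · simp only [KagomeAdjRel]
    rintro ((⟨rfl, -⟩ | ⟨rfl, rfl, rfl⟩ | ⟨rfl, rfl, rfl⟩ | ⟨rfl, rfl, rfl⟩) |
        (⟨rfl, -⟩ | ⟨rfl, rfl, rfl⟩ | ⟨rfl, rfl, rfl⟩ | ⟨rfl, rfl, rfl⟩))
    · exact Or.inl rfl
    · exact Or.inr (by simp)
    · exact Or.inr (by simp)
    · exact Or.inr (by simp)
    · exact Or.inl rfl
    · exact Or.inr (by simp)
    · exact Or.inr (by simp)
    · exact Or.inr (by simp)
  · rintro (rfl | h)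
    · exact Or.inl (Or.inl ⟨rfl, fun hst => hne (Prod.ext rfl hst)⟩)
    · obtain rfl : y = kagomeDownShift t - kagomeDownShift s + x := by
        rw [← sub_add_cancel y (kagomeDownShift t), ← h]; abel
      have hst : s ≠ t := by
        rintro rfl
        exact hne (by rw [sub_self, zero_add])
      have key : ∀ s t : Fin 3, s ≠ t →
          KagomeAdjRel ℤ ((0 : Site 2), s) (kagomeDownShift t - kagomeDownShift s, t) ∨
            KagomeAdjRel ℤ (kagomeDownShift t - kagomeDownShift s, t) ((0 : Site 2), s) := by
        decide
      have e₁ := kagomeAdjRel_shift_iff x ((0 : Site 2), s)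
        (kagomeDownShift t - kagomeDownShift s, t)
      have e₂ := kagomeAdjRel_shift_iff x (kagomeDownShift t - kagomeDownShift s, t)
        ((0 : Site 2), s)
      simp only [zero_add] at e₁ e₂
      rw [e₁, e₂]
      exact key s t hst

/-- **Adjacency in the kagome lattice by cells**: two kagome sites are adjacent iff they are
distinct and lie in a common up triangle (same cell) or in a common down triangle (same down cell
`x - kagomeDownShift s`). (Savary–Balents 2017, §6.4.2: corner-sharing triangles.)
[cite: SavaryBalents2017, §6.4.2] -/
theorem kagomeGraph_adj_iff_cell (a b : KagomeVertex) :
    kagomeGraph.Adj a b ↔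
      a ≠ b ∧ (a.1 = b.1 ∨ a.1 - kagomeDownShift a.2 = b.1 - kagomeDownShift b.2) := by
  rw [kagomeGraph_adj_iff]
  exact and_congr_right fun hne => kagomeAdjRel_or_symm_iff_cell hne

/-- Adjacency of the images in the line graph of the honeycomb lattice: the honeycomb edges of two
kagome sites are distinct and share a face iff the sites are distinct and share their up cell or
their down cell. [folklore] -/
theorem lineGraph_adj_kagomeToHexEdge_iff (a b : KagomeVertex) :
    hexGraph.lineGraph.Adj (kagomeToHexEdge a) (kagomeToHexEdge b) ↔
      a ≠ b ∧ (a.1 = b.1 ∨ a.1 - kagomeDownShift a.2 = b.1 - kagomeDownShift b.2) := by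
  rw [SimpleGraph.lineGraph_adj_iff_exists, kagomeToHexEdge_injective.ne_iff]
  refine and_congr_right fun _ => ?_
  simp only [coe_kagomeToHexEdge, kagomeHexEdge, Sym2.mem_iff]
  constructor
  · rintro ⟨F, rfl | rfl, h | h⟩
    · exact Or.inl (Prod.mk.inj h).1
    · exact absurd (Prod.mk.inj h).2 (by decide)
    · exact absurd (Prod.mk.inj h).2 (by decide)
    · exact Or.inr (Prod.mk.inj h).1
  · rintro (h | h)
    · exact ⟨(a.1, 0), Or.inl rfl, Or.inl (by rw [h])⟩
    · exact ⟨(a.1 - kagomeDownShift a.2, 1), Or.inr rfl, Or.inr (by rw [h])⟩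

/-! ### The isomorphism -/

/-- **The kagome lattice is the line graph of the honeycomb lattice**, as an explicit graph
isomorphism `kagomeGraph ≃g hexGraph.lineGraph` sending the kagome site `(x, s)` to the honeycomb
edge `{(x, 0), (x - kagomeDownShift s, 1)}` (`kagomeToHexEdge`). (The kagomé lattice as the line
graph of the hexagonal lattice: Mielke, J. Phys. A **25** (1992) 4335; Savary–Balents 2017,
§6.4.2.) [cite: SavaryBalents2017, §6.4.2] -/
noncomputable def kagomeIsoLineGraphHex : kagomeGraph ≃g hexGraph.lineGraph where
  toEquiv := Equiv.ofBijective kagomeToHexEdge kagomeToHexEdge_bijective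
  map_rel_iff' := by
    intro a b
    change hexGraph.lineGraph.Adj (kagomeToHexEdge a) (kagomeToHexEdge b) ↔ kagomeGraph.Adj a b
    rw [lineGraph_adj_kagomeToHexEdge_iff, kagomeGraph_adj_iff_cell]

/-- `kagomeIsoLineGraphHex` is `kagomeToHexEdge` on vertices. [folklore] -/
@[simp] theorem kagomeIsoLineGraphHex_apply (v : KagomeVertex) :
    kagomeIsoLineGraphHex v = kagomeToHexEdge v := rfl

/-- **Discharge of `kagomeGraph_iso_lineGraph_hexGraph`**: the kagome lattice `kagomeGraph` is
isomorphic to the line graph of the honeycomb lattice `hexGraph` (witness `kagomeIsoLineGraphHex`).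
(Savary–Balents, *Quantum spin liquids: a review*, Rep. Prog. Phys. **80** (2017) 016502 =
arXiv:1601.03742, §6.4.2 "Kagomé models": the kagomé lattice of corner-sharing triangles; the
line-graph description is that of Mielke, J. Phys. A **25** (1992) 4335.)
[cite: SavaryBalents2017, §6.4.2] -/
theorem kagomeGraph_iso_lineGraph_hexGraph_holds : kagomeGraph_iso_lineGraph_hexGraph :=
  ⟨kagomeIsoLineGraphHex⟩

end Literature.MathematicalPhysics.QuantumLattice
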